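import Summits.BirchSwinnertonDyer.BirchSwinnertonDyer.Theorems.ConjSpanGenAllLevelsDecomposition
import Literature.Geometry.Kaehler.ComplexTorusQuaternionUnitGroupFinitelyGeneratedSplit
import HarnessLib

/-!
# Finiteness inputs for the bottom of E-es-25 (MEMO-es §23): `Γ₀(N)` is finitely generated, homomorphisms from finitely
# generated groups into torsion abelian groups have finite range, and a homomorphism on `Δ_t(L')` killing the Borel
# `B⁺` has the range of its restriction to `ι Γ₀(L')`

Summit `BirchSwinnertonDyer`, cruxes C3 `ManinPrimeToThreeAtNine` (stmt-BirchSwinnertonDyer-22968) / C2 `ManinOddAtFour`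
(stmt-22967), route `ManinLocalTwoThree` (cell bsd-f2-manin); leaf `RelativeIharaShiftVanishingBar p t n` ⟸ E-es-35
`ShiftInvariantIsDiamond` whose bottom needs (es: «Γ₀(L) f.g. and (K,+) 𝔽_p-elementary ⟹ im u finite») the FINITE RANGE of
the glued homomorphism `δΦ` on `Δ_t(L')` before the congruence subgroup property applies (lead's
`…DeltaHomCongruence.exists_level_kills_of_finite_range`).  This file supplies exactly that, from Mathlib:
* `fg_gamma0` — `Γ₀(N)` is finitely generated (tree: `groupFG_SL2Z`; finite index
  `instFiniteIndexGamma0`; Schreier `Subgroup.fg_of_index_ne_zero`);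
* `finite_range_of_isTorsion` — a hom from a f.g. group to a torsion COMMUTATIVE group has finite range
  (`CommGroup.finite_of_fg_torsion`); `isTorsion_multiplicative_of_charP` — `(K, +)` is `p`-torsion in characteristic `p`;
* `finite_range_of_kills_upperB` — for `ψ : Δ_t(L') →* G` (commutative torsion `G`) killing `B⁺ ∩ Δ_t(L')`, the range is
  finite (`Δ_t(L') = ι Γ₀(L') · B⁺`, bsd-f3-mu's `deltaEqGamma0MulUpper`).
Nothing about BSD or Manin's conjecture is proved here.
-/

set_option autoImplicit false
set_option linter.dupNamespace false

open scoped MatrixGroups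

open CongruenceSubgroup Summit.BirchSwinnertonDyer.BirchSwinnertonDyer.Theorems.ConjSpanGenAllLevels

namespace Summit.BirchSwinnertonDyer.BirchSwinnertonDyer.Theorems.ManinLocalTwoThree

/-- **`Γ₀(N)` is finitely generated** (finite index in the finitely generated `SL₂(ℤ)`; Schreier). [folklore] -/
theorem fg_gamma0 (N : ℕ) [NeZero N] : Group.FG (Gamma0 N) := by
  haveI : Group.FG SL(2, ℤ) := Literature.Geometry.Kaehler.ComplexTorus.QuaternionType.groupFG_SL2Z
  exact Subgroup.fg_of_index_ne_zero (Gamma0 N)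

/-- **A homomorphism from a finitely generated group to a torsion commutative group has finite range.** [folklore] -/
theorem finite_range_of_isTorsion {G H : Type*} [Group G] [CommGroup H] [Group.FG G] (f : G →* H)
    (hH : Monoid.IsTorsion H) : Finite f.range := by
  haveI : Group.FG f.range := Group.fg_range f
  refine CommGroup.finite_of_fg_torsion (G := f.range) (fun x => ?_)
  exact Submonoid.isOfFinOrder_coe.mp (hH x.1)

/-- **`(K, +)` is torsion in positive characteristic**: every element of `Multiplicative K` has order dividing `p`.
[folklore] -/
theorem isTorsion_multiplicative_of_charP (K : Type*) [Ring K] (p : ℕ) [Fact p.Prime] [CharP K p] :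
    Monoid.IsTorsion (Multiplicative K) := by
  intro x
  rw [isOfFinOrder_iff_pow_eq_one]
  refine ⟨p, (Fact.out : p.Prime).pos, ?_⟩
  rw [← ofAdd_toAdd x, ← ofAdd_nsmul, nsmul_eq_mul, CharP.cast_eq_zero, zero_mul, ofAdd_zero]

section DeltaRange

variable {t L' : ℕ} {G : Type*} [CommGroup G]

/-- The inclusion `ι : Γ₀(L') → Δ_t(L')` as a homomorphism (plumbing; `gamma0Image_le_Delta`). [folklore] -/
theorem iota_gamma0_mem_Delta (γ : Gamma0 L') : iota t (γ : SL(2, ℤ)) ∈ Delta t L' :=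
  gamma0Image_le_Delta ⟨(γ : SL(2, ℤ)), γ.2, rfl⟩

/-- **Range reduction to `ι Γ₀(L')`**: for `t` prime, `t ∤ L'`, a homomorphism `ψ` on `Δ_t(L')` that kills every
upper-triangular element of `Δ_t(L')` takes all its values already on `ι Γ₀(L')` (`Δ = ι Γ₀(L')·B⁺`,
`deltaEqGamma0MulUpper`). [folklore] -/
theorem range_le_of_kills_upperB (ht : t.Prime) (hL' : ¬ t ∣ L') (ψ : Delta t L' →* G)
    (hB : ∀ (b : SL(2, Away t)) (hb : b ∈ Delta t L'), b 1 0 = 0 → ψ ⟨b, hb⟩ = 1) :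
    ψ.range ≤ (ψ.comp (((iota t).comp (Gamma0 L').subtype).codRestrict (Delta t L') iota_gamma0_mem_Delta)).range := by
  rintro _ ⟨⟨g, hg⟩, rfl⟩
  obtain ⟨γ, hγ, b, hb, hgb⟩ := deltaEqGamma0MulUpper ht hL' g hg
  have hbΔ : b ∈ Delta t L' := upperB_le_Delta hb
  refine ⟨⟨γ, hγ⟩, ?_⟩
  have hsplit : (⟨g, hg⟩ : Delta t L') = ⟨iota t γ, iota_gamma0_mem_Delta ⟨γ, hγ⟩⟩ * ⟨b, hbΔ⟩ := Subtype.ext hgb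
  rw [hsplit, map_mul, hB b hbΔ hb, mul_one]
  rfl

/-- **Finite range on `Δ_t(L')`**: for `t` prime, `t ∤ L'`, `L' ≥ 1`, a homomorphism `ψ : Δ_t(L') → G` into a torsion
commutative group which kills every upper-triangular element of `Δ_t(L')` has finite range (it factors its values through the
finitely generated `Γ₀(L')`). [folklore] -/
theorem finite_range_of_kills_upperB (ht : t.Prime) (hL' : ¬ t ∣ L') [NeZero L'] (ψ : Delta t L' →* G)
    (hG : Monoid.IsTorsion G)
    (hB : ∀ (b : SL(2, Away t)) (hb : b ∈ Delta t L'), b 1 0 = 0 → ψ ⟨b, hb⟩ = 1) : Finite ψ.range := by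
  haveI := fg_gamma0 L'
  have hfin := finite_range_of_isTorsion
    (ψ.comp (((iota t).comp (Gamma0 L').subtype).codRestrict (Delta t L') iota_gamma0_mem_Delta)) hG
  exact Finite.Set.subset _ (range_le_of_kills_upperB ht hL' ψ hB)

end DeltaRange

end Summit.BirchSwinnertonDyer.BirchSwinnertonDyer.Theorems.ManinLocalTwoThree
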